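import Summits.NavierStokesRegularity.NavierStokesRegularity.Theorems.CalmPocketDoorDefs
import Summits.NavierStokesRegularity.NavierStokesRegularity.Theorems.PeepholeVorticityDoorFrameTools
import Summits.NavierStokesRegularity.NavierStokesRegularity.Theorems.QuietScarPocketDoorFrame
import Literature.Analysis.FluidPDE.LerayHopfSpaceTranslate
import Literature.Analysis.FluidPDE.CheskidovShvydkoyRegular
import Literature.Analysis.FluidPDE.ClassicalSolutionRescale

/-!
# CalmPocketDoorFrame — ROUND-30 door S32 «CalmPocketDoor», plate PT32:
# **`frameTransfer32_holds : FrameTransfer32`** (`CalmPocketRegularity → TargetCalmPocket`)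

Seat nsreg-C26-p1 g4 (S-door lane; LEAD ns-s30-p1 g2 word 2026-08-28T12:12:18Z «PT32 → C26-p1: GO»); texts of record
nsreg-p1 `r30/Sketch32.lean` v2 d8e333116c9f1838 = tree `Theorems/CalmPocketDoorDefs.lean` (P0 p632304); plan `r30/PLATE-AID-32.md`
v2 §PT32.  `--supports stmt-NavierStokesRegularity-0056 --as helper`.

THE TRANSFER.  Physical data at `(ν, M, κ)`: answer with the unit door's `(ε, R_u)` as `(ε, R := R_u/2)`.  Given `(u,p)` on
`[0,T)`, a point `x₀` and a scale `λ` (`λ² ≤ νT`):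
* RESTART the Leray–Hopf evolution at a time `s` of the early half-window `(T − λ²/ν, T − λ²/(2ν))`
  (`IsLerayHopfOn.exists_isLerayHopfOn_restart_Ioo`; the `L³` datum bound `‖u s‖₃ ≤ Mν` holds at every such `s`);
* `μ := √(ν(T − s))`, so `λ²/2 < μ² < λ²` — in particular `μ ≤ λ` and `2μ > λ` (no `√2` bookkeeping needed);
* UNIT PAIR `v τ y = (μ/ν) u(s + μ²τ/ν, x₀ + μy)`, `q = (μ/ν)² p(…)`: classical on `[0,1)` with `ν = 1`
  (`IsClassicalNSSolutionOn.stRescale`, `α = μ/ν`, `γ = μ`, `β = μ²/ν`, viscosity `αν/γ = 1`); Leray–Hopf on `[0,1]` from `v 0`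
  by TRANSLATION (`IsLerayHopfOn.comp_add_space`, Literature p633071) + Leray SCALING (`isLerayHopfOn_nsRescale`) + VISCOSITY
  normalisation (`IsLerayHopfOn.viscosityRescale` with `c = ν⁻¹`): window `((T−s)/μ²)/ν⁻¹ = 1`, viscosity `ν⁻¹ν = 1`;
* CHECKS: `‖v 0‖₃ = ‖u s‖₃/ν ≤ M` (critical scaling of `L³`, `eLpNorm_nsRescaleData_of_ne_zero`); exterior region
  `¼ < ‖y‖ < 2R_u` ↦ `μ/4 < ‖x − x₀‖ < 2R_u μ`, inside `(λ/8, 4Rλ)` because `2μ > λ`, `μ ≤ λ`; `‖v‖ ≤ Mμ/λ ≤ M`,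
  `|q| ≤ Mμ²/λ² ≤ M`; pocket centre `y₁ = (x₁ − x₀)/μ`, `1 ≤ λ/μ ≤ ‖y₁‖ ≤ Rλ/(2μ) ≤ R_u/2` (again `2μ > λ`), radius `κ ≤ κλ/μ`;
  calmness `‖v τ y‖ = (μ/ν)‖u t x‖ ≤ (μ/λ) ε ≤ ε` eventually as `τ ↑ 1 ⇔ t ↑ T` (inlined `τ ↦ τ − 1` shift,
  `tendsto_time_affine_nhdsLT`);
* CONCLUSION `IsBackwardBoundedAt v 1 0 ⇒ IsBackwardBoundedAt u T x₀` (`isBackwardBoundedAt_of_pv_bound` with `λ' = μ`,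
  `β = μ²/ν`, `σ = τ − 1`, using `s + μ²/ν = T`).

HONEST FRAME: routine support plate of the S32 regularity CRITERION (exterior calm pocket ⇒ regular, conditional on the
Barker–Prange 2021 Prop. 10 tree fact by name at the closers); the class CONTAINS Type-II cores; item 0056 `NoTypeII` and
Navier–Stokes regularity are NOT proved and stay OPEN.
-/

noncomputable section

open MeasureTheory Set Function Filter Topology TopologicalSpace Metric
open scoped RealInnerProductSpace Topology ENNReal
open Literature.Analysis Literature.Analysis.FluidPDE
open Summit.NavierStokesRegularity.NavierStokesRegularity.Theorems.PeepholeVorticityDoor (isBackwardBoundedAt_of_pv_bound)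
open Summit.NavierStokesRegularity.NavierStokesRegularity.Theorems.QuietScarPocketDoor (tendsto_time_affine_nhdsLT)

set_option linter.dupNamespace false

namespace Summit.NavierStokesRegularity.NavierStokesRegularity.Theorems.CalmPocketDoor

/-! ### §1 The unit pair: Leray–Hopf, classical, critical datum -/

/-- **Leray–Hopf in the unit frame.**  If `u(· + s)` is Leray–Hopf on `[0, T − s)` from `u s` (viscosity `ν > 0`, no force) and
`μ > 0`, `μ² = ν(T − s)`, then `v τ y = (μ/ν) u(s + μ²τ/ν, x₀ + μ y)` is Leray–Hopf on `[0,1)` with viscosity `1` from `v 0`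
(translation by `x₀`, Leray scaling by `μ`, viscosity normalisation by `ν⁻¹`). -/
theorem unitFrame_isLerayHopfOn {ν T s μ : ℝ} (hν : 0 < ν) (hμ : 0 < μ) (hμ2 : μ ^ 2 = ν * (T - s))
    {u : ℝ → EuclideanSpace ℝ (Fin 3) → EuclideanSpace ℝ (Fin 3)} (x₀ : EuclideanSpace ℝ (Fin 3))
    (hLH : IsLerayHopfOn (T - s) ν 0 (u s) (fun t => u (t + s))) :
    IsLerayHopfOn 1 1 0 (((μ / ν) • stPull (μ ^ 2 / ν) μ s x₀ u) 0) ((μ / ν) • stPull (μ ^ 2 / ν) μ s x₀ u) := by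
  have hTs : 0 < T - s := by
    have : 0 < ν * (T - s) := by rw [← hμ2]; positivity
    exact pos_of_mul_pos_right this hν.le
  -- translation
  have h2 := hLH.comp_add_space x₀
  change IsLerayHopfOn (T - s) ν 0 (fun x => u s (x₀ + x)) (fun t x => u (t + s) (x₀ + x)) at h2
  -- Leray scaling by `μ`
  have h3 := isLerayHopfOn_nsRescale h2 hμ
  rw [nsRescaleForce_zero] at h3
  -- viscosity normalisation by `ν⁻¹`
  have h4 := h3.viscosityRescale (inv_pos.2 hν)
  have e1 : (T - s) / μ ^ 2 / ν⁻¹ = 1 := by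
    rw [hμ2]; field_simp
  have e2 : ν⁻¹ * ν = 1 := inv_mul_cancel₀ hν.ne'
  have hD : ν⁻¹ • nsRescaleData μ (fun x => u s (x₀ + x)) = ((μ / ν) • stPull (μ ^ 2 / ν) μ s x₀ u) 0 := by
    funext y
    simp only [Pi.smul_apply, nsRescaleData_apply, smul_stPull_apply, smul_smul, mul_zero, add_zero]
    rw [show ν⁻¹ * μ = μ / ν by ring]
  have hV : timeRescale ν⁻¹ ν⁻¹ (nsRescale μ (fun t x => u (t + s) (x₀ + x))) =
      (μ / ν) • stPull (μ ^ 2 / ν) μ s x₀ u := by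
    funext τ y
    simp only [timeRescale_apply, nsRescale_apply, smul_stPull_apply, smul_smul]
    rw [show μ ^ 2 * (ν⁻¹ * τ) + s = s + μ ^ 2 / ν * τ by ring, show ν⁻¹ * μ = μ / ν by ring]
  rw [e1, e2, timeRescale_zero_force, hD, hV] at h4
  exact h4

/-- **Classical in the unit frame.**  `(u,p)` classical on `[0,T)` (viscosity `ν`), `0 < s`, `μ > 0`, `μ² = ν(T−s)` ⇒ the unit pair
`v = (μ/ν) u(s + μ²·/ν, x₀ + μ·)`, `q = (μ/ν)² p(…)` is classical on `[0,1)` with viscosity `1`. -/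
theorem unitFrame_isClassical {ν T s μ : ℝ} (hν : 0 < ν) (hs : 0 < s) (hμ : 0 < μ) (hμ2 : μ ^ 2 = ν * (T - s))
    {u : ℝ → EuclideanSpace ℝ (Fin 3) → EuclideanSpace ℝ (Fin 3)} {p : ℝ → EuclideanSpace ℝ (Fin 3) → ℝ}
    (hcl : IsClassicalNSSolutionOn (Ico 0 T) ν 0 u p) (x₀ : EuclideanSpace ℝ (Fin 3)) :
    IsClassicalNSSolutionOn (Ico (0 : ℝ) 1) 1 0 ((μ / ν) • stPull (μ ^ 2 / ν) μ s x₀ u)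
      ((μ / ν) ^ 2 • stPull (μ ^ 2 / ν) μ s x₀ p) := by
  have hα : 0 < μ / ν := by positivity
  have h := hcl.stRescale hα hμ (show μ ^ 2 / ν = μ / ν * μ by field_simp) s x₀
  rw [smul_stPull_zero, show μ / ν * ν / μ = 1 by field_simp] at h
  refine h.mono ?_ (uniqueDiffOn_Ico 0 1)
  intro τ hτ
  rw [mem_preimage, mem_Ico]
  have hβ : μ ^ 2 / ν = T - s := by rw [hμ2]; field_simp
  have hTs : 0 < T - s := by
    have : 0 < ν * (T - s) := by rw [← hμ2]; positivity
    exact pos_of_mul_pos_right this hν.le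
  rw [hβ]
  constructor
  · nlinarith [hτ.1, hTs, hs]
  · nlinarith [hτ.2, hTs]

/-- Translation invariance of `L^p` norms on `ℝ³` (no measurability needed). -/
theorem eLpNorm_comp_add_eq (q : ℝ≥0∞) (x₀ : EuclideanSpace ℝ (Fin 3))
    (w : EuclideanSpace ℝ (Fin 3) → EuclideanSpace ℝ (Fin 3)) :
    eLpNorm (fun x => w (x₀ + x)) q volume = eLpNorm w q volume := by
  have hemb : MeasurableEmbedding (fun x : EuclideanSpace ℝ (Fin 3) => x₀ + x) :=
    (MeasurableEquiv.addLeft x₀).measurableEmbedding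
  rw [show (fun x => w (x₀ + x)) = w ∘ (fun x : EuclideanSpace ℝ (Fin 3) => x₀ + x) from rfl,
    ← hemb.eLpNorm_map_measure, map_add_left_eq_self]

/-- **Critical scaling of the `L³` datum**: `‖(μ/ν) w(x₀ + μ ·)‖₃ = ‖w‖₃ / ν` on `ℝ³` (`μ > 0`, `ν > 0`). -/
theorem eLpNorm_three_unitFrame {ν μ : ℝ} (hν : 0 < ν) (hμ : 0 < μ) (x₀ : EuclideanSpace ℝ (Fin 3))
    (w : EuclideanSpace ℝ (Fin 3) → EuclideanSpace ℝ (Fin 3)) :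
    eLpNorm (fun y => (μ / ν) • w (x₀ + μ • y)) 3 volume = ENNReal.ofReal ν⁻¹ * eLpNorm w 3 volume := by
  have hrepr : (fun y => (μ / ν) • w (x₀ + μ • y)) = nsRescaleData μ (fun x => ν⁻¹ • w (x₀ + x)) := by
    funext y
    rw [nsRescaleData_apply, smul_smul, show μ * ν⁻¹ = μ / ν by ring]
  rw [hrepr, eLpNorm_nsRescaleData_of_ne_zero 3 _ hμ.ne', finrank_euclideanSpace_fin,
    show (fun x => ν⁻¹ • w (x₀ + x)) = ν⁻¹ • (fun x => w (x₀ + x)) from rfl, eLpNorm_const_smul,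
    eLpNorm_comp_add_eq, Real.enorm_eq_ofReal hμ.le, Real.enorm_eq_ofReal (inv_nonneg.2 hν.le),
    abs_of_pos (inv_pos.2 (pow_pos hμ 3))]
  have h13 : (1 / 3 : ℝ≥0∞).toReal = ((3 : ℕ) : ℝ)⁻¹ := by
    rw [one_div, ENNReal.toReal_inv]; norm_num
  rw [h13, ENNReal.ofReal_rpow_of_nonneg (inv_nonneg.2 (pow_pos hμ 3).le) (by positivity),
    Real.inv_rpow (pow_pos hμ 3).le, Real.pow_rpow_inv_natCast hμ.le (by norm_num), ← mul_assoc,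
    ← ENNReal.ofReal_mul hμ.le, mul_inv_cancel₀ hμ.ne', ENNReal.ofReal_one, one_mul]

/-! ### §2 The frame transfer -/

/-- **PLATE PT32 · `FrameTransfer32` HOLDS** (module docstring): `CalmPocketRegularity → TargetCalmPocket`. -/
theorem frameTransfer32_holds : FrameTransfer32 := by
  intro h ν hν M hM κ hκ hκ2
  obtain ⟨ε, hε, Ru, hRu, H⟩ := h M hM κ hκ hκ2
  refine ⟨ε, hε, Ru / 2, by linarith, ?_⟩
  intro u p T hT hcl hLH x₀ lam hlam hlamT hL3 hext hpocket
  -- ### the restart time `s`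
  have ha0 : 0 ≤ T - lam ^ 2 / ν := by
    have : lam ^ 2 / ν ≤ T := by rw [div_le_iff₀ hν]; linarith
    linarith
  have hab : T - lam ^ 2 / ν < T - lam ^ 2 / (2 * ν) := by
    have h1 : lam ^ 2 / (2 * ν) < lam ^ 2 / ν := by
      rw [div_lt_div_iff₀ (by positivity) hν]; nlinarith [pow_pos hlam 2]
    linarith
  have hbT : T - lam ^ 2 / (2 * ν) ≤ T := by
    have : 0 ≤ lam ^ 2 / (2 * ν) := by positivity
    linarith
  obtain ⟨s, hs, hLHs⟩ := hLH.exists_isLerayHopfOn_restart_Ioo hν.le ha0 hab hbT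
  obtain ⟨hs1, hs2⟩ := hs
  have hs0 : 0 < s := by
    -- `T − λ²/ν ≥ 0` and `s` lies strictly above it
    linarith
  have hsT : s < T := lt_of_lt_of_le hs2 hbT
  -- ### the scale `μ`
  set μ : ℝ := Real.sqrt (ν * (T - s)) with hμ_def
  have hμ : 0 < μ := Real.sqrt_pos.2 (mul_pos hν (by linarith))
  have hμ2 : μ ^ 2 = ν * (T - s) := Real.sq_sqrt (by positivity)
  have hβ : μ ^ 2 / ν = T - s := by rw [hμ2]; field_simp
  have hβpos : 0 < μ ^ 2 / ν := by positivity
  -- `λ²/2 < μ² < λ²`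
  have hμlam2 : μ ^ 2 < lam ^ 2 := by
    rw [hμ2]
    have : T - s < lam ^ 2 / ν := by linarith
    calc ν * (T - s) < ν * (lam ^ 2 / ν) := mul_lt_mul_of_pos_left this hν
      _ = lam ^ 2 := by field_simp
  have hlamμ2 : lam ^ 2 < 2 * μ ^ 2 := by
    rw [hμ2]
    have : lam ^ 2 / (2 * ν) < T - s := by linarith
    have h2 : lam ^ 2 < 2 * ν * (T - s) := by
      rw [div_lt_iff₀ (by positivity)] at this; linarith
    linarith
  have hμlam : μ ≤ lam := by nlinarith [hμ, hlam]
  have hlam2μ : lam < 2 * μ := by nlinarith [hμ, hlam]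
  have hμν : 0 < μ / ν := by positivity
  -- ### the unit pair
  set v : ℝ → EuclideanSpace ℝ (Fin 3) → EuclideanSpace ℝ (Fin 3) := (μ / ν) • stPull (μ ^ 2 / ν) μ s x₀ u with hv_def
  set q : ℝ → EuclideanSpace ℝ (Fin 3) → ℝ := (μ / ν) ^ 2 • stPull (μ ^ 2 / ν) μ s x₀ p with hq_def
  have hvapp : ∀ τ y, v τ y = (μ / ν) • u (s + μ ^ 2 / ν * τ) (x₀ + μ • y) := fun τ y => rfl
  have hqapp : ∀ τ y, q τ y = (μ / ν) ^ 2 * p (s + μ ^ 2 / ν * τ) (x₀ + μ • y) := fun τ y => rfl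
  have hvcl : IsClassicalNSSolutionOn (Ico (0 : ℝ) 1) 1 0 v q := unitFrame_isClassical hν hs0 hμ hμ2 hcl x₀
  have hvLH : IsLerayHopfOn 1 1 0 (v 0) v := unitFrame_isLerayHopfOn hν hμ hμ2 x₀ hLHs
  -- critical datum
  have hv0 : eLpNorm (v 0) 3 volume ≤ ENNReal.ofReal M := by
    have e : v 0 = fun y => (μ / ν) • u s (x₀ + μ • y) := by
      funext y; rw [hvapp, mul_zero, add_zero]
    rw [e, eLpNorm_three_unitFrame hν hμ x₀ (u s)]
    calc ENNReal.ofReal ν⁻¹ * eLpNorm (u s) 3 volume ≤ ENNReal.ofReal ν⁻¹ * ENNReal.ofReal (M * ν) := by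
          gcongr; exact hL3 s ⟨hs1, hs2⟩
      _ = ENNReal.ofReal M := by
          rw [← ENNReal.ofReal_mul (inv_nonneg.2 hν.le)]
          congr 1; field_simp
  -- physical times and points of the unit frame
  have htime : ∀ τ ∈ Ioo (0 : ℝ) 1, s + μ ^ 2 / ν * τ ∈ Ioo (T - lam ^ 2 / ν) T := by
    intro τ hτ
    rw [hβ]
    constructor <;> nlinarith [hτ.1, hτ.2, hs1, hsT]
  have hexterior : ∀ τ ∈ Ioo (0 : ℝ) 1, ∀ y : EuclideanSpace ℝ (Fin 3), 1 / 4 < ‖y‖ → ‖y‖ < 2 * Ru →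
      ‖v τ y‖ ≤ M ∧ |q τ y| ≤ M := by
    intro τ hτ y hy1 hy2
    have hnorm : ‖x₀ + μ • y - x₀‖ = μ * ‖y‖ := by
      rw [add_sub_cancel_left, norm_smul, Real.norm_of_nonneg hμ.le]
    have h1 : lam / 8 < ‖x₀ + μ • y - x₀‖ := by rw [hnorm]; nlinarith
    have h2 : ‖x₀ + μ • y - x₀‖ < 4 * (Ru / 2) * lam := by
      rw [hnorm]
      calc μ * ‖y‖ < μ * (2 * Ru) := mul_lt_mul_of_pos_left hy2 hμ
        _ ≤ lam * (2 * Ru) := mul_le_mul_of_nonneg_right hμlam (by linarith)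
        _ = 4 * (Ru / 2) * lam := by ring
    obtain ⟨hu, hp⟩ := hext _ (htime τ hτ) _ h1 h2
    refine ⟨?_, ?_⟩
    · rw [hvapp, norm_smul, Real.norm_of_nonneg hμν.le]
      calc μ / ν * ‖u (s + μ ^ 2 / ν * τ) (x₀ + μ • y)‖ ≤ μ / ν * (M * ν / lam) :=
            mul_le_mul_of_nonneg_left hu hμν.le
        _ = M * (μ / lam) := by field_simp
        _ ≤ M * 1 := mul_le_mul_of_nonneg_left ((div_le_one hlam).2 hμlam) hM.le
        _ = M := mul_one M
    · rw [hqapp, abs_mul, abs_of_nonneg (sq_nonneg _)]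
      calc (μ / ν) ^ 2 * |p (s + μ ^ 2 / ν * τ) (x₀ + μ • y)| ≤ (μ / ν) ^ 2 * (M * ν ^ 2 / lam ^ 2) :=
            mul_le_mul_of_nonneg_left hp (sq_nonneg _)
        _ = M * (μ ^ 2 / lam ^ 2) := by field_simp
        _ ≤ M * 1 := mul_le_mul_of_nonneg_left ((div_le_one (pow_pos hlam 2)).2 hμlam2.le) hM.le
        _ = M := mul_one M
  have hclass : ExteriorClass M Ru v q := ⟨hvcl, hvLH, hv0, hexterior⟩
  -- ### the pocket in the unit frame
  obtain ⟨x₁, hx₁1, hx₁2, hcalm⟩ := hpocket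
  set y₁ : EuclideanSpace ℝ (Fin 3) := μ⁻¹ • (x₁ - x₀) with hy₁_def
  have hy₁n : ‖y₁‖ = μ⁻¹ * ‖x₁ - x₀‖ := by
    rw [hy₁_def, norm_smul, Real.norm_of_nonneg (inv_nonneg.2 hμ.le)]
  have hy₁1 : 1 ≤ ‖y₁‖ := by
    rw [hy₁n, le_inv_mul_iff₀ hμ, mul_one]; exact hμlam.trans hx₁1
  have hy₁2 : ‖y₁‖ ≤ Ru / 2 := by
    rw [hy₁n, inv_mul_le_iff₀ hμ]
    calc ‖x₁ - x₀‖ ≤ Ru / 2 * lam / 2 := hx₁2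
      _ ≤ μ * (Ru / 2) := by nlinarith
  -- time change `τ ↦ s + (μ²/ν) τ = T + (μ²/ν)(τ − 1)` sends `τ ↑ 1` to `t ↑ T`
  have htchange : Tendsto (fun τ : ℝ => s + μ ^ 2 / ν * τ) (𝓝[<] (1 : ℝ)) (𝓝[<] T) := by
    -- `τ ↦ τ − 1` maps `τ ↑ 1` to `σ ↑ 0` (as `CalmPocketDoor.tendsto_sub_one_nhdsLT` of the F32 file, inlined here)
    have hsub1 : Tendsto (fun t : ℝ => t - 1) (𝓝[<] (1 : ℝ)) (𝓝[<] (0 : ℝ)) := by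
      refine tendsto_nhdsWithin_of_tendsto_nhds_of_eventually_within _ ?_ ?_
      · have hc : Continuous fun t : ℝ => t - 1 := continuous_id.sub continuous_const
        simpa using (hc.tendsto (1 : ℝ)).mono_left nhdsWithin_le_nhds
      · filter_upwards [self_mem_nhdsWithin] with t ht
        have ht' : t < 1 := ht
        show t - 1 < 0
        linarith
    have h1 := (tendsto_time_affine_nhdsLT (T := T) hβpos).comp hsub1
    refine h1.congr fun τ => ?_
    simp only [Function.comp_apply]
    rw [hβ]; ring
  have hcalm' : ∀ y ∈ ball y₁ κ, ∀ᶠ τ in 𝓝[<] (1 : ℝ), ‖v τ y‖ ≤ ε := by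
    intro y hy
    set x : EuclideanSpace ℝ (Fin 3) := x₀ + μ • y with hx_def
    have hx : x ∈ ball x₁ (κ * lam) := by
      rw [mem_ball, dist_eq_norm] at hy ⊢
      have e : x - x₁ = μ • (y - y₁) := by
        rw [hx_def, hy₁_def, smul_sub, smul_smul, mul_inv_cancel₀ hμ.ne', one_smul]; abel
      rw [e, norm_smul, Real.norm_of_nonneg hμ.le]
      calc μ * ‖y - y₁‖ < μ * κ := mul_lt_mul_of_pos_left hy hμ
        _ ≤ lam * κ := mul_le_mul_of_nonneg_right hμlam hκ.le
        _ = κ * lam := mul_comm _ _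
    have hq' := htchange.eventually (hcalm x hx)
    filter_upwards [hq'] with τ hτ
    rw [hvapp, norm_smul, Real.norm_of_nonneg hμν.le]
    have hu : ‖u (s + μ ^ 2 / ν * τ) x‖ ≤ ν * ε / lam := by
      rw [le_div_iff₀ hlam]; linarith
    calc μ / ν * ‖u (s + μ ^ 2 / ν * τ) (x₀ + μ • y)‖ ≤ μ / ν * (ν * ε / lam) :=
          mul_le_mul_of_nonneg_left hu hμν.le
      _ = ε * (μ / lam) := by field_simp
      _ ≤ ε * 1 := mul_le_mul_of_nonneg_left ((div_le_one hlam).2 hμlam) hε.le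
      _ = ε := mul_one ε
  -- ### the unit door and the pull-back of its conclusion
  obtain ⟨r, hr, C, hC⟩ := H v q hclass ⟨y₁, hy₁1, hy₁2, hcalm'⟩
  refine isBackwardBoundedAt_of_pv_bound (β := μ ^ 2 / ν) (lam := μ) (ϱ := r) (B := C) hν hβpos hμ hr ?_
  intro σ hσ1 hσ2 z hz
  have hτ : 1 + σ ∈ Ioo (1 - r ^ 2) 1 := ⟨by linarith, by linarith⟩
  have key := hC (1 + σ) hτ z hz
  have e : ((μ / ν) • stPull (μ ^ 2 / ν) μ T x₀ u) σ z = v (1 + σ) z := by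
    rw [smul_stPull_apply, hvapp]
    congr 2
    rw [mul_add, mul_one, hβ]; ring
  rw [e]
  exact key

end Summit.NavierStokesRegularity.NavierStokesRegularity.Theorems.CalmPocketDoor

end
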